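import Summits.PneNP.PneNP.Theses.PermanentDescent
import Summits.PneNP.PneNP.Theorems.PermanentDescentPermanentNotInPStubPermSharpP
import Summits.PneNP.PneNP.Theorems.PermanentDescentPermanentNotInPStubPermBitsPPP
import Summits.PneNP.PneNP.Theorems.PermanentNotInP.Negative.CounterModelCollapse
import Literature.Computability.Complexity.PRelSigmaPi

/-!
# Route PermanentDescent, crux `PermanentNotInP` (stmt-PneNP-16143): the crux is EXACTLY `P ≠ PP`

Calibration of the crux `Summit.PneNP.PneNP.Theses.PermanentDescent.PermanentNotInP` (`PermBits ∉ P`,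
`PermBits = {⟨s, bin i⟩ : |s| = n², bit i of perm_ℕ(M_s) = 1}`), line `Sketch` (xp-ladder), lead c2:

* `permBits_mem_PRelClass_PP` — **`PermBits ∈ P^{PP}`**, the UPPER bound on the crux language: the 0/1
  permanent is a `#P`-style witness count of a polynomial-time one-hot permutation relation
  (`stub_permSharpP`, worker W1, p165424), and binary search with the `PP` threshold oracle recovers all its
  digits (`stub_permBits_mem_PRelClass_PP_of_sharpP`, worker W2, p164657, over the tree's
  `BinSearchPP.countsLang_mem_PRelClass_PP`);
* `stub_crux_iff_not_PP_subset_P` (registered side stub of line `Sketch`) — **`PermanentNotInP ↔ ¬ PP ⊆ P`**: upward by the bound above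
  (`PP ⊆ P ⟹ P^{PP} ⊆ P^{P} = P ∋ PermBits`), downward by Valiant's theorem as discharged in the tree
  (`Negative.PP_subset_P_of_not_permanentNotInP`, the crux disprover's p161539:
  `PermBits ∈ P ⟹ PP ⊆ P^{#P} ⊆ P^{per} ⊆ P`);
* `permanentNotInP_iff_exists_PP_not_mem_P` — the same as `∃ L ∈ PP, L ∉ P` (the open stub of the other
  registered line `birth`, which is thereby shown to be the crux verbatim).

So the tree now certifies in both directions what the route header, the strategy census and the
Disproof state in prose: this crux is the separation `P ≠ PP` (`⟺ P ≠ P^{#P} ⟺ P ≠ CH`), implied by the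
summit and implying `P ≠ PSPACE`; every rung/stub of a line for it must be measured against that.

Lead prover-line-stmt-PneNP-16143-c2-0 (continuation c2), `--supports stmt-PneNP-16143`.
-/

set_option linter.dupNamespace false -- `Summit.PneNP.PneNP.…`: summit = sub-problem name (D-0017 single-conjunct layout)

namespace Summit.PneNP.PneNP.Theorems.XpLadder

open Literature.Computability.Complexity Summit.PneNP.PneNP.Theses.PermanentDescent

/-- **`PermBits ∈ P^{PP}`**: the bit-graph language of the 0/1 permanent is decidable in polynomial
time with an oracle from `PP` (witness count in `#P` shape + binary search with the threshold oracle).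
[cite: Valiant1979, §2] [cite: AroraBarak2009, Lemma 17.7 (proof)] -/
theorem permBits_mem_PRelClass_PP :
    ({w | ∃ (n : ℕ) (s : List Bool) (i : ℕ), s.length = n * n ∧
        w = Literature.Computability.Complexity.boolPair s (Computability.encodeNat i) ∧
        Nat.testBit (Matrix.permanent (Matrix.of fun a b : Fin n =>
          if s.getD ((b : ℕ) + n * (a : ℕ)) false then (1 : ℕ) else 0)) i = true} : Language Bool) ∈
      PRelClass PP :=
  stub_permBits_mem_PRelClass_PP_of_sharpP stub_permSharpP

/-- **The crux `PermanentNotInP` is exactly `P ≠ PP`**: `PermBits ∉ P ↔ ¬ PP ⊆ P`. Upward: if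
`PP ⊆ P` then `P^{PP} ⊆ P^{P} = P` (`PRelClass_mono`, `PRelClass_P_subset_P`) contains `PermBits`
(`permBits_mem_PRelClass_PP`). Downward: a polynomial-time `PermBits` collapses `PP` to `P` by Valiant's
`#P`-hardness of the 0/1 permanent (`Negative.PP_subset_P_of_not_permanentNotInP`).
[cite: Valiant1979, Thm. 1] [cite: AroraBarak2009, Lemma 17.7] -/
theorem stub_crux_iff_not_PP_subset_P : Summit.PneNP.PneNP.Theses.PermanentDescent.PermanentNotInP ↔ ¬ (Literature.Computability.Complexity.PP ⊆ Literature.Computability.Complexity.Classes.P) := by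
  constructor
  · intro hcrux hPP
    exact hcrux (PRelClass_P_subset_P (PRelClass_mono hPP permBits_mem_PRelClass_PP))
  · intro hPP hP
    exact hPP (Summit.PneNP.PneNP.Theorems.PermanentNotInP.Negative.PP_subset_P_of_not_permanentNotInP
      fun h => h hP)

/-- **Equivalently: some language of `PP` is not in `P`** — the open stub `stub_PP_not_subset_P` of the
line `birth` of this crux, verbatim; that line's transfer is therefore an equivalence. [cite: Valiant1979, Thm. 1] -/
theorem permanentNotInP_iff_exists_PP_not_mem_P : PermanentNotInP ↔ ∃ L ∈ PP, L ∉ Classes.P := by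
  rw [stub_crux_iff_not_PP_subset_P, Set.not_subset]

end Summit.PneNP.PneNP.Theorems.XpLadder
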